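import Mathlib
import Summits.ValiantsHypothesis.ValiantsHypothesis.Theorems.BinomialElusiveBinomialCandidateAffinePeeling

/-!
# Crux `BinomialElusive.BinomialCandidate` (stmt-ValiantsHypothesis-7392), line `registered` —
# stub `stub_crossCap`, piece 2: evaluating an `A⟦X⟧`-ideal membership at Laurent series

Truncation/evaluation step of the cross-cap argument.  Let `A := ℂ⟦W_1, …, W_m⟧`, let
`F₀, F₁ ∈ ℂ[W][X]` be polynomials (coerced into `A⟦X⟧`), and suppose `D ∈ A` satisfies
`C D = U F₀ + V F₁` in `A⟦X⟧`.  Substitute Laurent series `T_i(t)`, `x(t)` of positive order for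
`W_i`, `X`: if `F₀(T, x)` and `F₁(T, x)` vanish below `t^n`, then so does `D_{<n}(T)`, where
`D_{<n} = truncTotal n D ∈ ℂ[W]` is the truncation of `D` below total degree `n`
(`crossCap_evaluation`).

No topology is used: every element of `A⟦X⟧` is congruent to a polynomial modulo the monomials
`W^d X^j` with `j + |d| ≥ n` ("small" series), small series form an ideal, a small polynomial
evaluates into `t^n ℂ⟦t⟧`, and `Polynomial.eval₂ (MvPolynomial.aeval T) x` is a ring homomorphism
on polynomials.  Mathlib only (plus `AffinePeeling.algebraMap_laurentSeries_apply` of wave 1).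
-/

-- layout Summits/ValiantsHypothesis/ValiantsHypothesis forces the duplicated namespace component
set_option linter.dupNamespace false

noncomputable section

namespace Summit.ValiantsHypothesis.ValiantsHypothesis.Theorems.BinomialCandidateStubs

open scoped BigOperators

namespace CrossCap

/-! ## Vanishing of low coefficients in `ℂ((t))` ("`x ≡ 0 (mod t^n)`") -/

section Laurent

variable {x y : LaurentSeries ℂ} {a b n : ℤ}

/-- Sums. -/
theorem vanish_add (hx : ∀ g < n, x.coeff g = 0) (hy : ∀ g < n, y.coeff g = 0) :
    ∀ g < n, (x + y).coeff g = 0 := fun g hg => by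
  simp [hx g hg, hy g hg]

/-- Differences. -/
theorem vanish_sub (hx : ∀ g < n, x.coeff g = 0) (hy : ∀ g < n, y.coeff g = 0) :
    ∀ g < n, (x - y).coeff g = 0 := fun g hg => by
  simp [hx g hg, hy g hg]

/-- Finite sums. -/
theorem vanish_sum {ι : Type*} (s : Finset ι) (u : ι → LaurentSeries ℂ)
    (hu : ∀ i ∈ s, ∀ g < n, (u i).coeff g = 0) : ∀ g < n, (∑ i ∈ s, u i).coeff g = 0 := by
  intro g hg
  rw [HahnSeries.coeff_sum]
  exact Finset.sum_eq_zero fun i hi => hu i hi g hg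

/-- Monotonicity in the level. -/
theorem vanish_mono (h : b ≤ a) (hx : ∀ g < a, x.coeff g = 0) : ∀ g < b, x.coeff g = 0 :=
  fun g hg => hx g (lt_of_lt_of_le hg h)

/-- Products: levels add (cf. `JetReduction.mul_mem_laurentSub` of the jet-reduction stub). -/
theorem vanish_mul (hx : ∀ g < a, x.coeff g = 0) (hy : ∀ g < b, y.coeff g = 0) :
    ∀ g < a + b, (x * y).coeff g = 0 := by
  intro g hg
  rw [HahnSeries.coeff_mul]
  refine Finset.sum_eq_zero fun ij hij => ?_
  rw [Finset.mem_antidiagonal] at hij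
  obtain ⟨h1, h2, h3⟩ := hij
  by_cases hi : ij.1 < a
  · exact absurd (hx _ hi) ((HahnSeries.mem_support _ _).mp h1)
  · have hj : ij.2 < b := by omega
    exact absurd (hy _ hj) ((HahnSeries.mem_support _ _).mp h2)

/-- Constants have nonnegative order. -/
theorem vanish_algebraMap (r : ℂ) :
    ∀ g < (0 : ℤ), (algebraMap ℂ (LaurentSeries ℂ) r).coeff g = 0 := by
  intro g hg
  rw [AffinePeeling.algebraMap_laurentSeries_apply, HahnSeries.coeff_single_of_ne hg.ne]

/-- Powers. -/
theorem vanish_pow (hx : ∀ g < a, x.coeff g = 0) (k : ℕ) : ∀ g < k * a, (x ^ k).coeff g = 0 := by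
  induction k with
  | zero =>
    simpa using vanish_algebraMap 1
  | succ k ih =>
    rw [pow_succ]
    have := vanish_mul ih hx
    push_cast
    rwa [add_mul, one_mul]

/-- Finite products: levels add. -/
theorem vanish_prod {ι : Type*} (s : Finset ι) (u : ι → LaurentSeries ℂ) (w : ι → ℤ)
    (hu : ∀ i ∈ s, ∀ g < w i, (u i).coeff g = 0) :
    ∀ g < ∑ i ∈ s, w i, (∏ i ∈ s, u i).coeff g = 0 := by
  classical
  induction s using Finset.induction_on with
  | empty => simpa using vanish_algebraMap 1
  | insert c s hc ih =>
    rw [Finset.prod_insert hc, Finset.sum_insert hc]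
    exact vanish_mul (hu c (by simp)) (ih fun i hi => hu i (Finset.mem_insert_of_mem hi))

end Laurent

/-! ## Evaluating polynomials with only high-degree monomials -/

section Aeval

variable {m : ℕ} (T : Fin m → LaurentSeries ℂ) (hT : ∀ i, ∀ g < (1 : ℤ), (T i).coeff g = 0)
include hT

/-- A polynomial all of whose monomials have total degree `≥ e`, evaluated at series of positive
order, vanishes below `t^e`. -/
theorem vanish_aeval (a : MvPolynomial (Fin m) ℂ) (e : ℕ)
    (ha : ∀ d : Fin m →₀ ℕ, d.degree < e → MvPolynomial.coeff d a = 0) :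
    ∀ g < (e : ℤ), (MvPolynomial.aeval T a).coeff g = 0 := by
  rw [MvPolynomial.as_sum a, map_sum]
  refine vanish_sum _ _ fun d hd => ?_
  rw [MvPolynomial.aeval_monomial, Finsupp.prod]
  have hprod := vanish_prod d.support (fun i => T i ^ d i) (fun i => (d i : ℤ))
    (fun i _ => by simpa using vanish_pow (hT i) (d i))
  have hdeg : (e : ℤ) ≤ ∑ i ∈ d.support, (d i : ℤ) := by
    have : e ≤ d.degree := by
      by_contra h
      exact (MvPolynomial.mem_support_iff.mp hd) (ha d (by omega))
    rw [Finsupp.degree_apply] at this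
    exact_mod_cast this
  have := vanish_mul (vanish_algebraMap (MvPolynomial.coeff d a)) hprod
  rw [zero_add] at this
  exact vanish_mono hdeg this

variable (x : LaurentSeries ℂ) (hx : ∀ g < (1 : ℤ), x.coeff g = 0)
include hx

/-- A polynomial in `X` over `ℂ[W]` all of whose monomials `W^d X^j` have `j + |d| ≥ n`, evaluated
at `W := T`, `X := x` (positive orders), vanishes below `t^n`. -/
theorem vanish_eval₂ (n : ℕ) (P : Polynomial (MvPolynomial (Fin m) ℂ))
    (hP : ∀ (j : ℕ) (d : Fin m →₀ ℕ), j + d.degree < n → MvPolynomial.coeff d (P.coeff j) = 0) :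
    ∀ g < (n : ℤ), (Polynomial.eval₂ (MvPolynomial.aeval T).toRingHom x P).coeff g = 0 := by
  rw [Polynomial.eval₂_eq_sum, Polynomial.sum_def]
  refine vanish_sum _ _ fun j _ => ?_
  change ∀ g < (n : ℤ), (MvPolynomial.aeval T (P.coeff j) * x ^ j).coeff g = 0
  by_cases hjn : j < n
  · have h1 := vanish_aeval T hT (P.coeff j) (n - j) fun d hd => hP j d (by omega)
    have := vanish_mul h1 (vanish_pow hx j)
    refine vanish_mono (le_of_eq ?_) this
    push_cast [Nat.cast_sub hjn.le]
    ring
  · have h1 := vanish_aeval T hT (P.coeff j) 0 fun d hd => absurd hd (Nat.not_lt_zero _)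
    have := vanish_mul h1 (vanish_pow hx j)
    refine vanish_mono ?_ this
    push_cast
    omega

end Aeval

/-! ## Small elements of `A⟦X⟧`: no monomial `W^d X^j` with `j + |d| < n` -/

section Small

variable {m n : ℕ}

/-- Small series form an ideal: a small series times anything is small. -/
theorem small_mul {Φ : PowerSeries (MvPowerSeries (Fin m) ℂ)}
    (hΦ : ∀ (j : ℕ) (d : Fin m →₀ ℕ), j + d.degree < n →
      MvPowerSeries.coeff d (PowerSeries.coeff j Φ) = 0)
    (Ψ : PowerSeries (MvPowerSeries (Fin m) ℂ)) :
    ∀ (j : ℕ) (d : Fin m →₀ ℕ), j + d.degree < n →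
      MvPowerSeries.coeff d (PowerSeries.coeff j (Φ * Ψ)) = 0 := by
  intro j d hjd
  rw [PowerSeries.coeff_mul, map_sum]
  refine Finset.sum_eq_zero fun jj hjj => ?_
  rw [MvPowerSeries.coeff_mul]
  refine Finset.sum_eq_zero fun dd hdd => ?_
  rw [Finset.HasAntidiagonal.mem_antidiagonal] at hjj hdd
  have h1 : jj.1 ≤ j := by rw [← hjj]; exact Nat.le_add_right _ _
  have h2 : dd.1.degree ≤ d.degree := by rw [← hdd, map_add]; exact Nat.le_add_right _ _
  rw [hΦ jj.1 dd.1 (by omega), zero_mul]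

/-- The embedding `ℂ[W][X] → A⟦X⟧` on coefficients. -/
theorem coeff_coeff_coe (P : Polynomial (MvPolynomial (Fin m) ℂ)) (j : ℕ) (d : Fin m →₀ ℕ) :
    MvPowerSeries.coeff d (PowerSeries.coeff j
      ((P.map MvPolynomial.coeToMvPowerSeries.ringHom : Polynomial (MvPowerSeries (Fin m) ℂ)) :
        PowerSeries (MvPowerSeries (Fin m) ℂ))) = MvPolynomial.coeff d (P.coeff j) := by
  simp [Polynomial.coeff_coe]

/-- Every element of `A⟦X⟧` is congruent to a polynomial modulo small series: subtract the
truncation `Σ_{j<n} (truncTotal n Φ_j) X^j`. -/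
theorem small_sub_trunc (Φ : PowerSeries (MvPowerSeries (Fin m) ℂ)) :
    ∀ (j : ℕ) (d : Fin m →₀ ℕ), j + d.degree < n →
      MvPowerSeries.coeff d (PowerSeries.coeff j (Φ -
        (((∑ j' ∈ Finset.range n, Polynomial.monomial j'
          (MvPowerSeries.truncTotal n (PowerSeries.coeff j' Φ))).map
            MvPolynomial.coeToMvPowerSeries.ringHom : Polynomial (MvPowerSeries (Fin m) ℂ)) :
          PowerSeries (MvPowerSeries (Fin m) ℂ)))) = 0 := by
  classical
  intro j d hjd
  rw [map_sub, map_sub, coeff_coeff_coe, Polynomial.finsetSum_coeff]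
  simp only [Polynomial.coeff_monomial, Finset.sum_ite_eq', Finset.mem_range]
  rw [if_pos (by omega), MvPowerSeries.coeff_truncTotal _ (by omega), sub_self]

/-- The constant series `C D` is congruent to the constant polynomial `C (truncTotal n D)`. -/
theorem small_C_sub (D : MvPowerSeries (Fin m) ℂ) :
    ∀ (j : ℕ) (d : Fin m →₀ ℕ), j + d.degree < n →
      MvPowerSeries.coeff d (PowerSeries.coeff j
        ((((Polynomial.C (MvPowerSeries.truncTotal n D)).map MvPolynomial.coeToMvPowerSeries.ringHom :
            Polynomial (MvPowerSeries (Fin m) ℂ)) : PowerSeries (MvPowerSeries (Fin m) ℂ)) -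
          PowerSeries.C D)) = 0 := by
  intro j d hjd
  rw [map_sub, map_sub, coeff_coeff_coe, Polynomial.coeff_C, PowerSeries.coeff_C]
  split_ifs with hj
  · rw [MvPowerSeries.coeff_truncTotal _ (by omega), sub_self]
  · simp

end Small

end CrossCap

open CrossCap in
/-- **Evaluation of an `A⟦X⟧`-ideal membership** (piece 2 of the stub `stub_crossCap`).
`A = ℂ⟦W_1, …, W_m⟧`; if `C D = U F₀ + V F₁` in `A⟦X⟧` for polynomials `F₀, F₁ ∈ ℂ[W][X]`, and
Laurent series `T_i`, `x` of positive order make `F₀(T, x)` and `F₁(T, x)` vanish below `t^n`,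
then the truncation `truncTotal n D ∈ ℂ[W]` evaluated at `T` vanishes below `t^n`. -/
theorem crossCap_evaluation :
    ∀ (m n : ℕ) (F₀ F₁ : Polynomial (MvPolynomial (Fin m) ℂ)) (D : MvPowerSeries (Fin m) ℂ)
      (U V : PowerSeries (MvPowerSeries (Fin m) ℂ)) (T : Fin m → LaurentSeries ℂ)
      (x : LaurentSeries ℂ),
      PowerSeries.C D =
        U * ((F₀.map MvPolynomial.coeToMvPowerSeries.ringHom : Polynomial (MvPowerSeries (Fin m) ℂ)) :
          PowerSeries (MvPowerSeries (Fin m) ℂ)) +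
        V * ((F₁.map MvPolynomial.coeToMvPowerSeries.ringHom : Polynomial (MvPowerSeries (Fin m) ℂ)) :
          PowerSeries (MvPowerSeries (Fin m) ℂ)) →
      (∀ i, ∀ g : ℤ, g < 1 → (T i).coeff g = 0) → (∀ g : ℤ, g < 1 → x.coeff g = 0) →
      (∀ g : ℤ, g < n → (Polynomial.eval₂ (MvPolynomial.aeval T).toRingHom x F₀).coeff g = 0) →
      (∀ g : ℤ, g < n → (Polynomial.eval₂ (MvPolynomial.aeval T).toRingHom x F₁).coeff g = 0) →
      ∀ g : ℤ, g < n → (MvPolynomial.aeval T (MvPowerSeries.truncTotal n D)).coeff g = 0 := by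
  intro m n F₀ F₁ D U V T x hD hT hx hF₀ hF₁
  -- the embedding `ℂ[W][X] → A⟦X⟧` as a ring homomorphism
  set ι : Polynomial (MvPolynomial (Fin m) ℂ) →+* PowerSeries (MvPowerSeries (Fin m) ℂ) :=
    (Polynomial.coeToPowerSeries.ringHom).comp
      (Polynomial.mapRingHom MvPolynomial.coeToMvPowerSeries.ringHom) with hι
  have hιapp : ∀ P : Polynomial (MvPolynomial (Fin m) ℂ), ι P =
      ((P.map MvPolynomial.coeToMvPowerSeries.ringHom : Polynomial (MvPowerSeries (Fin m) ℂ)) :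
        PowerSeries (MvPowerSeries (Fin m) ℂ)) := fun P => rfl
  -- polynomial truncations of `U`, `V`
  set τU : Polynomial (MvPolynomial (Fin m) ℂ) := ∑ j' ∈ Finset.range n, Polynomial.monomial j'
    (MvPowerSeries.truncTotal n (PowerSeries.coeff j' U)) with hτU
  set τV : Polynomial (MvPolynomial (Fin m) ℂ) := ∑ j' ∈ Finset.range n, Polynomial.monomial j'
    (MvPowerSeries.truncTotal n (PowerSeries.coeff j' V)) with hτV
  set P₀ : Polynomial (MvPolynomial (Fin m) ℂ) :=
    Polynomial.C (MvPowerSeries.truncTotal n D) - τU * F₀ - τV * F₁ with hP₀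
  -- `ι P₀` is small
  have key : ι P₀ = (ι (Polynomial.C (MvPowerSeries.truncTotal n D)) - PowerSeries.C D) +
      (U - ι τU) * ι F₀ + (V - ι τV) * ι F₁ := by
    rw [hP₀, map_sub, map_sub, map_mul, map_mul, hιapp F₀, hιapp F₁, hD]
    ring
  have hsmall : ∀ (j : ℕ) (d : Fin m →₀ ℕ), j + d.degree < n →
      MvPowerSeries.coeff d (PowerSeries.coeff j (ι P₀)) = 0 := by
    intro j d hjd
    rw [key, map_add, map_add, map_add, map_add, hιapp, hιapp τU, hιapp τV, small_C_sub D j d hjd,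
      small_mul (small_sub_trunc U) _ j d hjd, small_mul (small_sub_trunc V) _ j d hjd, add_zero,
      add_zero]
  have hP₀coeff : ∀ (j : ℕ) (d : Fin m →₀ ℕ), j + d.degree < n →
      MvPolynomial.coeff d (P₀.coeff j) = 0 := by
    intro j d hjd
    rw [← coeff_coeff_coe, ← hιapp]
    exact hsmall j d hjd
  -- evaluate
  have hev := vanish_eval₂ T hT x hx n P₀ hP₀coeff
  have hevU := vanish_eval₂ T hT x hx 0 τU fun j d hjd => absurd hjd (Nat.not_lt_zero _)
  have hevV := vanish_eval₂ T hT x hx 0 τV fun j d hjd => absurd hjd (Nat.not_lt_zero _)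
  have h1 := vanish_mul hevU hF₀
  have h2 := vanish_mul hevV hF₁
  simp only [Nat.cast_zero, zero_add] at h1 h2
  have heq : MvPolynomial.aeval T (MvPowerSeries.truncTotal n D) =
      Polynomial.eval₂ (MvPolynomial.aeval T).toRingHom x P₀ +
        Polynomial.eval₂ (MvPolynomial.aeval T).toRingHom x τU *
          Polynomial.eval₂ (MvPolynomial.aeval T).toRingHom x F₀ +
        Polynomial.eval₂ (MvPolynomial.aeval T).toRingHom x τV *
          Polynomial.eval₂ (MvPolynomial.aeval T).toRingHom x F₁ := by
    rw [hP₀, Polynomial.eval₂_sub, Polynomial.eval₂_sub, Polynomial.eval₂_mul, Polynomial.eval₂_mul,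
      Polynomial.eval₂_C]
    simp only [AlgHom.toRingHom_eq_coe, RingHom.coe_coe]
    ring
  rw [heq]
  exact vanish_add (vanish_add hev h1) h2

end Summit.ValiantsHypothesis.ValiantsHypothesis.Theorems.BinomialCandidateStubs

end
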